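import Summits.QuantumFields.BalabanUV.T4Continuum.Support.NE7RoutePiRegimeSU2
import Summits.QuantumFields.BalabanUV.T4Continuum.Support.NE7CriticalPairSU2
import HarnessLib

/-!
# NE7OneStepOfExistence — ONE-STEP ⇐ EXISTENCE of ONE good tangent-critical configuration on every fibre of the data class (B11 Thm 1's
# EXISTENCE clause (8), p. 279) ∧ row NE3's per-pair binder `hleaves²` ∧ the two k-free lines: the a-priori estimate WITH GAIN (`hape` of F31)
# is DISCHARGED by gen 87's uniqueness of the critical orbit (F235 ∕ F236) — it is no longer a hypothesis of the NE7 END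

Cell `pub-balaban`, rung (B)+1 sub-cell t4, lineage `b2b-balaban-t4-ne7-p1` (CRUX PROVER NE7 #1 = OWNER of row NE7), generation 88; memo
`t4/b2b-balaban-t4-ne7-p1-g88/EXISTENCE-BY-INDUCTION.md` §1.  File F238 (over F31 `NE7OneStepOfRoutePi`, F33 `NE7RoutePiRegimeSU2`, F235
`NE7CriticalPairOfRoutePi`, F236 `NE7CriticalPairSU2`).

WHY.  F31 ∕ F33 (ONE-STEP END of record since gen 69) display `hape`: «every TANGENT-CRITICAL admissible `U` with `SmallField U (δ∕M²)` over a datum of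
`𝒟_β` has `SmallField U (δ₁∕M²)`» — [Balaban1985Variational] Sect. F TYPE, the wall.  Gen 87 proved (F235) that two tangent-critical admissible
configurations on ONE fibre, represented by row NE3's route-Π binder, are gauge equivalent, so `SmallField` transfers between them at every radius.
Hence `hape` follows from the mere EXISTENCE, on every fibre of `𝒟_β` and at every level, of ONE admissible tangent-critical `U♯` with
`SmallField U♯ (δ₁∕M²)` — which is [Balaban1985Variational] Thm 1's existence clause (8) p. 279 («there exists a minimal orbit in the space
`𝔘_k({Ω_j}, B₃ε₁) ∩ 𝔅_k(𝔅_k, V)`», a critical orbit of (5) on (6)) read in the tree's dictionary (`sfClass` = (6), `admissible` = (3), `TangentIter`-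
criticality), and NOT an a-priori estimate.  Print proves (8) by INDUCTION ON `k` (p. 279 «Theorem 1 will be proved by induction with respect to k»;
Sect. A (11): background = the previous minimiser over the REFINED datum `V₀`) — files F239 ∕ F240 of this generation type that induction.
WHAT ([folklore] composition; 0 def, 0 sorry).
§1 **`oneStep_of_dataClass_exists_routePi`** (generic `d`, `L ≥ 2`, every `N ≥ 1`): F31 §1 with `hape` REPLACED by
   `hexists : ∀ D ∈ 𝒟_β, ∀ k, ∃ U♯ ∈ admissible (sfClass d L N ε) L (k+1) D, SmallField U♯ (δ₁∕M²) ∧ U♯ tangent-critical`, and `hleaves` by `hleaves²`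
   = `hleaves` ∧ the FAR local quadratic letter `‖dirIter L (k+1) (U′^u) X₀ (z,κ)‖ ≤ C₂(M·m(z,κ))²` (the same leaf read at the far configuration — F237
   `NE7GaugedTwoTierFar`: it costs row NE3's (Π-REG-γ″) nothing).  Proof: F31 §1 at `hape := F235 ∘ hexists ∘ hleaves²`, `hleaves := hleaves²` minus its
   last conjunct.
§2 **`oneStep_SU2_of_dataClass_exists_routePi`** — `d = 4`, `L = 2`, `card n = 2`, `0 < ε ≤ 10⁻⁵³`: F33's END with the same replacement (F236 for the pair);
   displayed: the ceilings `C₂, α̂, Ĉ` and F31 ∕ F33's TWO k-free lines, NOTHING ELSE uniform.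
THE (A)-BILL AFTER THIS FILE: X-A4 ∧ **hexists** ([B11] Thm 1 (8) TYPE — existence, per fibre of `𝒟_β`, of ONE tangent-critical admissible configuration of
radius `δ₁∕M²`) ∧ `hleaves²` on `𝒟_β` ∧ two k-free lines.  GONE: the a-priori estimate with gain (Sect. F TYPE).
HONEST FRAMING (page 1).  Composition over HYPOTHESES; `hexists` (B11 Thm 1 (8) TYPE), row NE3's per-pair binder (B11 Prop. 2 ∕ (Π-REG-γ) TYPE) and the
numeric lines are asserted for nothing; `γ` inexplicit (F29's compactness); nothing of Bałaban's asserted; NOT ONE-STEP, NOT NE7; spine 0∕9; finite T⁴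
rung (B)+1 — NOT infinite volume, NOT mass gap, NOT `BetaPertH`, NOT Clay.  Continuum YM on T⁴ ⇐ BetaPertH ∧ nine spine estimates (0/9 proved); BetaPertH ⇐
(D1) ∧ (D4) ∧ CAP+tail; G-an2-4 gates asym, D1 and NE2/3/4.
-/

set_option autoImplicit false

open scoped BigOperators Matrix Matrix.Norms.L2Operator
open NormedSpace Finset Set

namespace Summit.QuantumFields.BalabanUV.T4Continuum.NE7OneStepOfExistence

open Literature.MathematicalPhysics.QuantumFieldTheory.Balaban1983to89
open B7Prop1Explicit B7Prop2Explicit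
open T4AveragingDeficitWall (IsUnitaryCfg IsSkewDir SmallField dirSq)
open T4AveragingDeficitWallBoundary (IsPeriodicCfg periodBox)
open AveragingDeficitPeriodicCounting (IsPeriodicDir)
open AveragingDeficitMultiLevelPrep (LevelSmall TangentIter)
open MinimalActionLevels (perWin)
open MinimalActionSandwich (IsMinimiser admissible)
open MinimalActionRate (sfClass)
open NE3HessForm (dAction)
open NE3SlicePoincareShape (SlicePoincare)
open NE3SlicePoincareBudgetLine (CPLine)
open NE3FrameFreeSliceW (frameFreeBlockLandauW)
open NE3TangentCovariantTower (dirIter)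
open NE3DecomposedRepOfLinearNormalPart (ResidualSliceRepT)
open NE3QbarIterCovLiftPrep (cruxC)
open NE3SmoothRightInverseW (rightInvW)
open NE3RightInverseSolveLetters (thetaLoc)
open NE3RightInverseL2Letter (l2C)
open NE3HatInvCurlLetters (curl2C curl1C)
open NE7OneStepOfRoutePi (oneStep_of_dataClass_ape_routePi)
open NE7RoutePiRegimeSU2 (oneStep_SU2_of_dataClass_ape_routePi')
open NE7CriticalPairOfRoutePi (smallField_of_tanCritical_pair_routePi)
open NE7CriticalPairSU2 (smallField_of_tanCritical_pair_SU2)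

noncomputable section

variable {d : ℕ} {n : Type*} [Fintype n] [DecidableEq n]

/-! ## §1 The END over the data class: existence of ONE good tangent-critical configuration per fibre replaces the a-priori estimate -/

set_option maxHeartbeats 400000 in
-- statement-level budget (the `hrep` binder), as in F30 ∕ F31
/-- **ONE-STEP FOR ALL SUFFICIENTLY SMALL DATA ⇐ EXISTENCE OF ONE GOOD TANGENT-CRITICAL CONFIGURATION PER FIBRE ∧ ROW NE3's `hleaves²` ON `𝒟_β`**
(generic `d`, `L ≥ 2`, every `N ≥ 1`): F31 §1 `oneStep_of_dataClass_ape_routePi` with its a-priori estimate `hape` REPLACED by `hexists` — for every datum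
`D ∈ 𝒟_β = {unitary, N-periodic, SmallField ≤ 4(e^β − 1)}` and every level `k+1` there is `U♯ ∈ admissible (sfClass d L N ε) L (k+1) D`, tangent-critical,
with `SmallField U♯ (δ₁∕M²)` ([Balaban1985Variational] Thm 1 (8) TYPE) — and `hleaves` by `hleaves²` (F31's per-pair binder plus the far local quadratic
letter at `U′^u`).  The gain for EVERY tangent-critical admissible `U` is then gen 87's uniqueness of the critical orbit (F235). [folklore] -/
theorem oneStep_of_dataClass_exists_routePi [Nonempty n] {L N : ℕ} [NeZero L] [NeZero N] (hL : 2 ≤ L) (hN : 1 ≤ N) {ε δ δ₁ CP β : ℝ}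
    (hε : 0 < ε) (hε1 : 16 * C0 d * ε ≤ 3) (hε2 : 1024 * (d + 1) * (d + 4) * (L : ℝ) ^ 2 * ε ≤ 1) (hδ₁ : 0 ≤ δ₁) (hδ₁δ : δ₁ < δ) (hδε : δ < ε)
    (hCP : 0 < CP) (hβ : 0 < β) (hls : ∀ k : ℕ, LevelSmall d L k (ε / ((L : ℝ) ^ (k + 1)) ^ 2))
    (hP : ∀ (j : ℕ) (W' : Site d → Fin d → (Matrix n n ℂ)ˣ), W' ∈ sfClass d L N ε (j + 1) →
      SlicePoincare L (j + 1) W' (frameFreeBlockLandauW L N (j + 1) W') CP (periodBox (d := d) (N * L ^ (j + 1))))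
    -- row NE3's right inverse regime (W6) and route Π's ceilings and two k-free lines
    (hθl : thetaLoc d L * ε < 1) (hε1' : ε ≤ 1) {C₂ αh Ch : ℝ} (hC₂ : 0 ≤ C₂) (hαh0 : 0 ≤ αh) (hαh1 : αh ≤ 1) (hCh0 : 0 ≤ Ch)
    {νh κh : ℝ} (hνh : νh = 2 * Real.sqrt (l2C d L / (1 - thetaLoc d L * ε) ^ 2 + curl2C d L / (1 - thetaLoc d L * ε) ^ 2) * C₂ * Ch * αh)
    (hκh : κh = 4 * (curl1C d L / (1 - thetaLoc d L * ε)) * C₂ * Ch ^ 2 * ε) (hν : νh < 1)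
    (hline : 2 * (κh / (1 - νh) ^ 2) < ((((1 / 2 - (νh / (1 - νh)) ^ 2) / (2 * (1 + CP)) - (νh / (1 - νh)) ^ 2) / 2
        - 576 * d * (αh ^ 2 * Real.exp (2 * αh))) / (Fintype.card n : ℝ) - 28 * d * (ε + 7 * αh ^ 2)))
    -- EXISTENCE of one good tangent-critical admissible configuration on every fibre of the data class ([B11] Thm 1 (8) TYPE)
    (hexists : ∀ D : Site d → Fin d → (Matrix n n ℂ)ˣ, IsUnitaryCfg D → IsPeriodicCfg D (N : ℤ) → SmallField D (4 * (Real.exp β - 1)) →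
      ∀ (k : ℕ), ∃ Us ∈ admissible (sfClass d L N ε) L (k + 1) D, SmallField Us (δ₁ / ((L : ℝ) ^ (k + 1)) ^ 2) ∧
      (∀ φ : Site d → Fin d → Matrix n n ℂ, IsSkewDir φ → IsPeriodicDir φ ((N * L ^ (k + 1) : ℕ) : ℤ) → TangentIter L k Us φ →
        dAction Us φ (perWin d (N * L ^ (k + 1))) = 0))
    -- ROW NE3's PER-PAIR BINDER on the data class, at the pairs (U♯, U′), WITH THE FAR LOCAL QUADRATIC LETTER
    (hleaves2 : ∀ D : Site d → Fin d → (Matrix n n ℂ)ˣ, IsUnitaryCfg D → IsPeriodicCfg D (N : ℤ) → SmallField D (4 * (Real.exp β - 1)) →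
      ∀ (k : ℕ), ∀ Us ∈ admissible (sfClass d L N ε) L (k + 1) D, SmallField Us (δ₁ / ((L : ℝ) ^ (k + 1)) ^ 2) →
      (∀ φ : Site d → Fin d → Matrix n n ℂ, IsSkewDir φ → IsPeriodicDir φ ((N * L ^ (k + 1) : ℕ) : ℤ) → TangentIter L k Us φ →
        dAction Us φ (perWin d (N * L ^ (k + 1))) = 0) →
      ∀ U' ∈ admissible (sfClass d L N ε) L (k + 1) D,
      ∃ (u : Site d → (Matrix n n ℂ)ˣ) (X₀ : Site d → Fin d → Matrix n n ℂ) (α₀ : ℝ) (m : Site d → Fin d → ℝ) (C : ℝ),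
        IsSkewDir X₀ ∧
        (∀ (hWu : IsUnitaryCfg Us) (hx : 0 ≤ ε / ((L : ℝ) ^ (k + 1)) ^ 2) (hs : LevelSmall d L k (ε / ((L : ℝ) ^ (k + 1)) ^ 2))
            (hWx : SmallField Us (ε / ((L : ℝ) ^ (k + 1)) ^ 2))
            (hθ : cruxC d L * (((L : ℝ) ^ (k + 1)) ^ 2 * (ε / ((L : ℝ) ^ (k + 1)) ^ 2)) < 1)
            (hφ : IsSkewDir (dirIter L (k + 1) Us X₀)),
          ResidualSliceRepT L N (k + 1) Us U' u X₀ (rightInvW hL k hWu hx hs hWx N hθ hφ) α₀) ∧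
        (∀ z κ, 0 ≤ m z κ) ∧ 0 ≤ C ∧
        ((L : ℝ) ^ (k + 1)) ^ d * ∑ z ∈ periodBox (d := d) N, ∑ κ : Fin d, m z κ ^ 2
          ≤ C ^ 2 * dirSq X₀ (periodBox (d := d) (N * L ^ (k + 1))) ∧
        (∀ z ∈ periodBox (d := d) N, ∀ κ : Fin d, ‖dirIter L (k + 1) Us X₀ z κ‖ ≤ C₂ * ((L : ℝ) ^ (k + 1) * m z κ) ^ 2) ∧
        α₀ * (L : ℝ) ^ (k + 1) ≤ αh ∧ (∀ z κ, m z κ * (L : ℝ) ^ (k + 1) ≤ αh) ∧ C ≤ Ch ∧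
        (∀ z ∈ periodBox (d := d) N, ∀ κ : Fin d, ‖dirIter L (k + 1) (gaugeAct u U') X₀ z κ‖ ≤ C₂ * ((L : ℝ) ^ (k + 1) * m z κ) ^ 2)) :
    ∃ γ : ℝ, 0 < γ ∧ ∀ V : Site d → Fin d → (Matrix n n ℂ)ˣ, IsUnitaryCfg V → IsPeriodicCfg V (N : ℤ) → SmallField V γ →
      ∀ (k : ℕ) (U₀ : Site d → Fin d → (Matrix n n ℂ)ˣ), U₀ ∈ admissible (sfClass d L N ε) L (k + 1) V →
        SmallField U₀ (δ / ((L : ℝ) ^ k) ^ 2) →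
        ∃ U, IsMinimiser d (sfClass d L N ε) L N (k + 1) V U ∧ SmallField U (δ / ((L : ℝ) ^ (k + 1)) ^ 2) := by
  refine oneStep_of_dataClass_ape_routePi hL hN hε hε1 hε2 hδ₁ hδ₁δ hδε hCP hβ hls hP hθl hε1' hC₂ hαh0 hαh1 hCh0 hνh hκh hν hline ?_ ?_
  · -- (APE) for EVERY tangent-critical admissible `U`: ONE good tangent-critical `U♯` on the fibre (hexists) + uniqueness of the critical orbit (F235)
    intro D hDu hDP hDs k U hU _hUsm hcrit
    obtain ⟨Us, hUs, hUssm, hcritT⟩ := hexists D hDu hDP hDs k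
    obtain ⟨u, X₀, α₀, m, C, hXs, hrep, hm0, hC, hsq, hφq, hαh, hmh, hCh, hφq'⟩ :=
      hleaves2 D hDu hDP hDs k Us hUs hUssm hcritT U hU
    exact smallField_of_tanCritical_pair_routePi hL k hε (hls k) hθl hε1' hC₂ hαh0 hαh1 hCh0 hCP hP hνh hκh hν hline hUs hU hcritT hcrit
      hXs hrep hm0 hC hsq hφq hαh hmh hCh hφq' hUssm
  · -- F31's `hleaves` is `hleaves²` without its last conjunct
    intro D hDu hDP hDs k Us hUs hUssm hcritT U' hU'
    obtain ⟨u, X₀, α₀, m, C, hXs, hrep, hm0, hC, hsq, hφq, hαh, hmh, hCh, -⟩ :=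
      hleaves2 D hDu hDP hDs k Us hUs hUssm hcritT U' hU'
    exact ⟨u, X₀, α₀, m, C, hXs, hrep, hm0, hC, hsq, hφq, hαh, hmh, hCh⟩

/-! ## §2 `d = 4`, `L = 2`, SU(2): the END of record of generation 88 before the induction files -/

set_option maxHeartbeats 400000 in
-- statement-level budget (the `hrep` binder), as in F31 ∕ F33
/-- **ONE-STEP AT `d = 4`, `L = 2`, SU(2)∕U(2) (`card n = 2`), `0 < ε ≤ 10⁻⁵³`, FOR ALL `γ`-SMALL DATA ⇐ hexists ∧ ROW NE3's `hleaves²` ON `𝒟_β`**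
((P♮)_W, the level family, the class smallness, `ε ≤ 1` and the W6 regime DISCHARGED as in F33; displayed uniformly: the ceilings `C₂, α̂, Ĉ` and the TWO
k-free lines).  F33's `oneStep_SU2_of_dataClass_ape_routePi'` with `hape` REPLACED by `hexists` ([Balaban1985Variational] Thm 1 (8) TYPE) through F236.
[folklore] -/
theorem oneStep_SU2_of_dataClass_exists_routePi [Nonempty n] (hn : Fintype.card n = 2) {N : ℕ} [NeZero N] (hN : 1 ≤ N) {ε δ δ₁ β : ℝ}
    (hε : 0 < ε) (hε' : ε ≤ 1 / 10 ^ 53) (hδ₁ : 0 ≤ δ₁) (hδ₁δ : δ₁ < δ) (hδε : δ < ε) (hβ : 0 < β)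
    {C₂ αh Ch : ℝ} (hC₂ : 0 ≤ C₂) (hαh0 : 0 ≤ αh) (hαh1 : αh ≤ 1) (hCh0 : 0 ≤ Ch)
    {νh κh : ℝ} (hνh : νh = 2 * Real.sqrt (l2C 4 2 / (1 - thetaLoc 4 2 * ε) ^ 2 + curl2C 4 2 / (1 - thetaLoc 4 2 * ε) ^ 2) * C₂ * Ch * αh)
    (hκh : κh = 4 * (curl1C 4 2 / (1 - thetaLoc 4 2 * ε)) * C₂ * Ch ^ 2 * ε) (hν : νh < 1)
    (hline : 2 * (κh / (1 - νh) ^ 2) < ((((1 / 2 - (νh / (1 - νh)) ^ 2) / (2 * (1 + (CPLine 4 2 2 (1 / 10 ^ 17) (1 / 10 ^ 53) + 1)))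
        - (νh / (1 - νh)) ^ 2) / 2 - 576 * (4 : ℕ) * (αh ^ 2 * Real.exp (2 * αh))) / (Fintype.card n : ℝ) - 28 * (4 : ℕ) * (ε + 7 * αh ^ 2)))
    (hexists : ∀ D : Site 4 → Fin 4 → (Matrix n n ℂ)ˣ, IsUnitaryCfg D → IsPeriodicCfg D (N : ℤ) → SmallField D (4 * (Real.exp β - 1)) →
      ∀ (k : ℕ), ∃ Us ∈ admissible (sfClass 4 2 N ε) 2 (k + 1) D, SmallField Us (δ₁ / ((((2 : ℕ) : ℝ)) ^ (k + 1)) ^ 2) ∧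
      (∀ φ : Site 4 → Fin 4 → Matrix n n ℂ, IsSkewDir φ → IsPeriodicDir φ ((N * 2 ^ (k + 1) : ℕ) : ℤ) → TangentIter 2 k Us φ →
        dAction Us φ (perWin 4 (N * 2 ^ (k + 1))) = 0))
    (hleaves2 : ∀ D : Site 4 → Fin 4 → (Matrix n n ℂ)ˣ, IsUnitaryCfg D → IsPeriodicCfg D (N : ℤ) → SmallField D (4 * (Real.exp β - 1)) →
      ∀ (k : ℕ), ∀ Us ∈ admissible (sfClass 4 2 N ε) 2 (k + 1) D, SmallField Us (δ₁ / ((((2 : ℕ) : ℝ)) ^ (k + 1)) ^ 2) →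
      (∀ φ : Site 4 → Fin 4 → Matrix n n ℂ, IsSkewDir φ → IsPeriodicDir φ ((N * 2 ^ (k + 1) : ℕ) : ℤ) → TangentIter 2 k Us φ →
        dAction Us φ (perWin 4 (N * 2 ^ (k + 1))) = 0) →
      ∀ U' ∈ admissible (sfClass 4 2 N ε) 2 (k + 1) D,
      ∃ (u : Site 4 → (Matrix n n ℂ)ˣ) (X₀ : Site 4 → Fin 4 → Matrix n n ℂ) (α₀ : ℝ) (m : Site 4 → Fin 4 → ℝ) (C : ℝ),
        IsSkewDir X₀ ∧
        (∀ (hWu : IsUnitaryCfg Us) (hx : 0 ≤ ε / ((((2 : ℕ) : ℝ)) ^ (k + 1)) ^ 2)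
            (hs : LevelSmall 4 2 k (ε / ((((2 : ℕ) : ℝ)) ^ (k + 1)) ^ 2)) (hWx : SmallField Us (ε / ((((2 : ℕ) : ℝ)) ^ (k + 1)) ^ 2))
            (hθ : cruxC 4 2 * (((((2 : ℕ) : ℝ)) ^ (k + 1)) ^ 2 * (ε / ((((2 : ℕ) : ℝ)) ^ (k + 1)) ^ 2)) < 1)
            (hφ : IsSkewDir (dirIter 2 (k + 1) Us X₀)),
          ResidualSliceRepT 2 N (k + 1) Us U' u X₀ (rightInvW (by norm_num) k hWu hx hs hWx N hθ hφ) α₀) ∧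
        (∀ z κ, 0 ≤ m z κ) ∧ 0 ≤ C ∧
        ((((2 : ℕ) : ℝ)) ^ (k + 1)) ^ 4 * ∑ z ∈ periodBox (d := 4) N, ∑ κ : Fin 4, m z κ ^ 2
          ≤ C ^ 2 * dirSq X₀ (periodBox (d := 4) (N * 2 ^ (k + 1))) ∧
        (∀ z ∈ periodBox (d := 4) N, ∀ κ : Fin 4, ‖dirIter 2 (k + 1) Us X₀ z κ‖ ≤ C₂ * ((((2 : ℕ) : ℝ)) ^ (k + 1) * m z κ) ^ 2) ∧
        α₀ * (((2 : ℕ) : ℝ)) ^ (k + 1) ≤ αh ∧ (∀ z κ, m z κ * (((2 : ℕ) : ℝ)) ^ (k + 1) ≤ αh) ∧ C ≤ Ch ∧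
        (∀ z ∈ periodBox (d := 4) N, ∀ κ : Fin 4,
          ‖dirIter 2 (k + 1) (gaugeAct u U') X₀ z κ‖ ≤ C₂ * ((((2 : ℕ) : ℝ)) ^ (k + 1) * m z κ) ^ 2)) :
    ∃ γ : ℝ, 0 < γ ∧ ∀ V : Site 4 → Fin 4 → (Matrix n n ℂ)ˣ, IsUnitaryCfg V → IsPeriodicCfg V (N : ℤ) → SmallField V γ →
      ∀ (k : ℕ) (U₀ : Site 4 → Fin 4 → (Matrix n n ℂ)ˣ), U₀ ∈ admissible (sfClass 4 2 N ε) 2 (k + 1) V →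
        SmallField U₀ (δ / ((((2 : ℕ) : ℝ)) ^ k) ^ 2) →
        ∃ U, IsMinimiser 4 (sfClass 4 2 N ε) 2 N (k + 1) V U ∧ SmallField U (δ / ((((2 : ℕ) : ℝ)) ^ (k + 1)) ^ 2) := by
  refine oneStep_SU2_of_dataClass_ape_routePi' hn hN hε hε' hδ₁ hδ₁δ hδε hβ hC₂ hαh0 hαh1 hCh0 hνh hκh hν hline ?_ ?_
  · intro D hDu hDP hDs k U hU _hUsm hcrit
    obtain ⟨Us, hUs, hUssm, hcritT⟩ := hexists D hDu hDP hDs k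
    obtain ⟨u, X₀, α₀, m, C, hXs, hrep, hm0, hC, hsq, hφq, hαh, hmh, hCh, hφq'⟩ :=
      hleaves2 D hDu hDP hDs k Us hUs hUssm hcritT U hU
    exact smallField_of_tanCritical_pair_SU2 hn hN k hε hε' hC₂ hαh0 hαh1 hCh0 hνh hκh hν hline hUs hU hcritT hcrit hXs hrep hm0 hC hsq
      hφq hαh hmh hCh hφq' hUssm
  · intro D hDu hDP hDs k Us hUs hUssm hcritT U' hU'
    obtain ⟨u, X₀, α₀, m, C, hXs, hrep, hm0, hC, hsq, hφq, hαh, hmh, hCh, -⟩ :=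
      hleaves2 D hDu hDP hDs k Us hUs hUssm hcritT U' hU'
    exact ⟨u, X₀, α₀, m, C, hXs, hrep, hm0, hC, hsq, hφq, hαh, hmh, hCh⟩

end

end Summit.QuantumFields.BalabanUV.T4Continuum.NE7OneStepOfExistence
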